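import Literature.MathematicalPhysics.QuantumFieldTheory.Balaban1983to89.B1Eq38Rescale
import Literature.MathematicalPhysics.QuantumFieldTheory.Balaban1983to89.B1Eq338Display

/-!
# `Balaban1983to89.B1Eq222Rescaling` — T. Bałaban, *(Higgs)₂,₃ quantum fields in a finite volume. I. A lower bound*,
Commun. Math. Phys. **85** (1982) 603–626 [Balaban1982Higgs1]: **(2.22)** p. 610, **(3.29)** p. 617 and **(3.38)**
p. 619 ON THE UNIT LATTICE — the choice `s = (L^kε)⁻¹` in the canonical rescaling (1.22): the rescaled propagator IS
literally `(−Δ^{η,N}_{A} + m²(L^kε)² + a_kP_k(A))^{−1}` (`eq222`), the background field of (3.38) IS `a_kG_kQ_k^*A` with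
that `G_k` (`bgVec_unit`, `extRescale_bgVec`), and **(3.38) for the (Higgs)₂,₃ model with every piece identified**
(`eq338_model`): unit-lattice `χ_k`, `L`-lattice `χ_{k+1}`, background `A^{(k)}`, and the printed bracket for an action
of the form (3.30) — ASSEMBLED from the typer's covariance lemmas (`HiggsBackgroundRescale`, `B1Eq38Rescale`) and
`B1Eq338Display.eq338`, PROVED

statement-level skeleton of published theorems with citation tags; proofs where landed; nothing here is a claim about the Yang–Mills mass gap

PDF held: `paper:balaban1982-cmp85-higgs23-i` (journal page = PDF page + 602).  (2.20)–(2.22) p. 610, (3.29) p. 617,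
(3.38)/(3.42) p. 619 READ AS IMAGES on the ×2 renders `run/shared/lean/pub/pub-balaban/b2b-balaban-ref1/pages/
1982-cmp85-higgs23-I/1982-cmp85-higgs23-I-p008-x2.png`, `…-p015-x2.png`, `…-p017-x2.png`, never from the OCR layer.

CITATION HEADER (lean-in-tree rule).  lit-balaban typed skeleton (HOME `run/shared/lean/pub/lit-balaban/`), SKELETON
rows **B1.Eq2.22** (owners r01/r14: «[DEF] rescaled propagator, typed p240513 `HiggsCovariance.propagatorRescaled`»;
general-`s` covariance `B1Eq38Rescale.propagatorK_rescale`, typer p248739), **B1.Eq3.29** («typed p239114 · concrete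
`B1Eq31Concrete.bgVec/bgScalar` p246064»; covariance `HiggsBackgroundRescale.bgVec_rescale`, typer p248523) and
**B1.Eq3.37–3.38**, the (3.38) member (owner r12; `B1Eq338Rescaling`/`B1Eq338Display` p248048/p248265, typer's
`integral337_unit` p248739); rows of record unchanged — this file adds PROVED members.  WHAT IS REPRODUCED, verbatim,
p. 610 [PDF 8]: *"In the sequel the properties of the propagator G^ε_k(Ω, A) rescaled to the η-lattice, η = L^{−k}, will
be very important. Let us notice that the rescaled propagator is given by G_k(Ω, A) = (−Δ^{η,N}_{A,Ω} + m²(L^kε)² +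
a_kP_k(A))^{−1}. (2.22)"*; p. 617: *"A^{(k),ε} = a_k(L^kε)^{−2}G^ε_kQ^*_kA (3.29)"*; p. 619 [PDF 17]: *"After the
rescaling the integral transforms into the integral const χ_{k+1}(B)χ_{k+1}(ψ)∫dA∫dφ χ_k(A)χ_k(φ) exp[−½aL^{d−2}Σ
|B(y)−(QA)(y)|² − ½aL^{d−2}Σ|ψ(y)−(Q(A^{(k)})φ)(y)|² − ½⟨A,Δ^{(k)}A⟩ − ½⟨φ,Δ^{(k)}(A^{(k)})φ⟩ + log Z_k + log Z_k(A^{(k)})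
+ 𝒫^{(k)}(A^{(k)},φ) − E₀] (3.38) … In the remaining part of the action the field A occurs only through the function
A^{(k)} … A^{(k)} = a_kG_kQ_k^*A′ + … (3.42)"*.

DICTIONARY.  The unit lattice of p. 618 = the parameter record `P₁ := P.scaleBy (unitScale P k) _`
(`B1Eq338Rescaling.unitScale P k = (L^kε)⁻¹`; spacing `1` at level `k`, `η = L^{−k}` at level `0`; `= Params.unitAt k` of
`HiggsCovariance.propagatorRescaled`, `B1Eq338Rescaling.unitScale_eq_unitAt`); (1.22) = `rescaleVec`/`rescaleScalar`,
`σ = (L^kε)^{−(d−2)/2}`; the rescaled constants of p. 607 at this `s`: `m²(L^kε)²`, `μ₀²(L^kε)²`, charge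
`e(L^kε)^{(4−d)/2}` (`ChargeData.scaleBy`); `G^ε_k(T, A)` = `HiggsCovariance.propagatorK … k` (`Ω = T`, p. 610 *"we will
use the case Ω = T_ε only"*); `A^{(k),ε}` = `B1Eq31Concrete.bgVec`; `χ_k`, `χ_{k+1}` = `B1Eq31Concrete.chiKA·chiKφ` at the
length scales `ℓ₀ = L^kε`, `ℓ₁ = L^{k+1}ε` (thresholds (3.27)–(3.28)), which the rescaling turns into the scales `1` and
`L` of `T_1^{(k)}`, `T_L^{(k+1)}`; the double transformation = `HiggsDoubleRT.doubleRTk`; the display (3.38) =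
`B1Eq338Display.display338`; the form (3.30) of `S^{(k)}` = `B1Sect3Statements.action330`.
WHAT THIS FILE PROVES (0 `sorry`; standard axioms): §1 `covOpK_unit` (on `P₁` the operator (2.20) with mass `m²(L^kε)²`
is `−Δ^{η,N}_A + m²(L^kε)² + a_kP_k(A)`: `a_k(L^kη)^{−2} = a_k`) and **`eq222`**: `G^ε_k(T, σÃ′)(σg′) = (L^kε)²·σ·
[(−Δ^{η,N}_{Ã′} + m²(L^kε)² + a_kP_k(Ã′))^{−1}g′]` (`m² > 0`, `a_k ≥ 0`; from `B1Eq38Rescale.propagatorK_rescale`),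
`propagatorRescaled_eq_cast` (that unit-lattice propagator, transported to the record `Params.unitAt k`, IS the decl of
record `HiggsCovariance.propagatorRescaled P e_s k T Ã′ m² a`); §2 **`extRescale_bgVec`** (the conjugated background
assignment `B1Eq338Rescaling.extRescale` of `A ↦ A^{(k),ε}_{μ₀²}` IS `A′ ↦ A^{(k),sε}_{μ₀²s⁻²}(A′)`, from
`HiggsBackgroundRescale.bgVec_rescale`) and `bgVec_unit` (on `P₁`:
`A^{(k)} = a_kG_kQ_k^*A`, the map of (3.38)/(3.42)); §3 **`eq338_model`**, **`eq338_model_printed`** — (3.38) for the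
model: `χ_{k+1}(σB′)χ_{k+1}(σB′,σψ′)·T^{L^kε}_{a,L}[T^{L^kε}_{a,L,A^{(k),ε}}[χ_kχ_k e^{−S^{(k)}}]](σB′,σψ′) = display338`
on `P₁` with the weights `χ^{1}_k`, `χ^{L}_{k+1}` OF THE UNIT LATTICE (masses `μ₀²(L^kε)²`, `m²(L^kε)²`, charge `e_s`),
the background `A ↦ a_kG_kQ_k^*A` of `P₁`, and the printed bracket of (3.38) for `S^{(k)}` of the form (3.30).
HONEST SCOPE.  (i) The six constituents of (3.30) are ARGUMENTS (rows B1.Eq3.30–3.36 type them schematically), pulled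
back under (1.22) as in `B1Eq338Display`; (ii) `m², μ₀² > 0`, `a ≥ 0` as in the typer's lemmas (true in print);
(iii) convergence of the integrals is neither used nor asserted; (iv) general `Ω ⊂ T` in (2.22) is not treated.
Unit `lit-balaban-p14` gen 5 (Phase-2 proof seat p14, literature-prover-lit-balaban-p14-g5-0), HOME
`run/shared/lean/pub/lit-balaban/` (seat log `lit-balaban-p14/STATUS.md`).
-/

open scoped BigOperators
open _root_.MeasureTheory _root_.Real

namespace Literature.MathematicalPhysics.QuantumFieldTheory.Balaban1983to89.B1Eq222Rescaling

open Literature.MathematicalPhysics.QuantumFieldTheory.Balaban1983to89.HiggsLattice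
open Literature.MathematicalPhysics.QuantumFieldTheory.Balaban1983to89.HiggsAveraging
open Literature.MathematicalPhysics.QuantumFieldTheory.Balaban1983to89.HiggsCovariance
open Literature.MathematicalPhysics.QuantumFieldTheory.Balaban1983to89.HiggsRescaling
open Literature.MathematicalPhysics.QuantumFieldTheory.Balaban1983to89.HiggsDoubleRT
open Literature.MathematicalPhysics.QuantumFieldTheory.Balaban1983to89.B3MultiscaleFields
  (toSite ofSite zeroCharge fluctOp topPiece)
open Literature.MathematicalPhysics.QuantumFieldTheory.Balaban1983to89.B1Eq31Concrete (bgVec chiKA chiKφ)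
open Literature.MathematicalPhysics.QuantumFieldTheory.Balaban1983to89.B1Ineq337HiggsModel (cutoffDensity)
open Literature.MathematicalPhysics.QuantumFieldTheory.Balaban1983to89.HiggsBackgroundRescale (bgVec_rescale)
open Literature.MathematicalPhysics.QuantumFieldTheory.Balaban1983to89.B1Eq38Rescale
  (propagatorK_rescale chiKA_rescale chiKφ_rescale)
open Literature.MathematicalPhysics.QuantumFieldTheory.Balaban1983to89.B1Sect3Statements (action330)
open Literature.MathematicalPhysics.QuantumFieldTheory.Balaban1983to89.B1Eq338Rescaling
open Literature.MathematicalPhysics.QuantumFieldTheory.Balaban1983to89.B1Eq338Display (display338 eq338)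

variable {P : Params} {N : ℕ} {s : ℝ}

/-! ## 1. (2.22): the propagator rescaled to the `η = L^{−k}` lattice, literally -/

section Propagator

/-- `((L^kε)⁻¹)⁻¹ = L^kε`. [cite: Balaban1982Higgs1, (2.22) p.610] -/
theorem unitScale_inv (P : Params) (k : ℕ) : (unitScale P k)⁻¹ = P.mesh k := by
  rw [unitScale, inv_inv]

/-- **The operator of (2.22), literally**: on the `η = L^{−k}` lattice `P₁` the operator (2.20) with the mass `m²(L^kε)²`
reads `−Δ^{η,N}_{A} + m²(L^kε)² + a_kP_k(A)` — the coefficient `a_k(L^kη)^{−2}` IS `a_k` since `L^kη = 1`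
(`B1Eq338Rescaling.unit_mesh_k`); this is the body of `HiggsCovariance.propagatorRescaled` over the record
`Params.unitAt k = P₁` (`unitScale_eq_unitAt`). PROVED. [cite: Balaban1982Higgs1, (2.22) p.610] -/
theorem covOpK_unit (C : ChargeData N) (k : ℕ)
    (A : VecField (P.scaleBy (unitScale P k) (unitScale_pos P k)) 0) (msq a : ℝ) :
    covOpK (P := P.scaleBy (unitScale P k) (unitScale_pos P k)) C Finset.univ A (msq * P.mesh k ^ 2) a k
      = covLaplacianN (P := P.scaleBy (unitScale P k) (unitScale_pos P k)) C Finset.univ A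
        + (msq * P.mesh k ^ 2) • LinearMap.id
        + B1.aSeq a P.L k • projPk (P := P.scaleBy (unitScale P k) (unitScale_pos P k)) C A k := by
  unfold covOpK
  rw [unit_mesh_k, inv_one, one_pow, mul_one]
  rfl

/-- **(2.22) p. 610 — "Let us notice that the rescaled propagator is given by G_k(Ω, A) = (−Δ^{η,N}_{A,Ω} + m²(L^kε)²
+ a_kP_k(A))^{−1}"** (`Ω = T`): for a configuration `Ã′` and a function `g′` on the `η = L^{−k}` lattice and their
canonical rescalings `σÃ′`, `σg′` (1.22) to the `ε`-lattice, `σ = (L^kε)^{−(d−2)/2}`, the propagator (2.20) satisfies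
`G^ε_k(T, σÃ′)(σg′) = (L^kε)² · σ · [(−Δ^{η,N}_{Ã′} + m²(L^kε)² + a_kP_k(Ã′))^{−1} g′]` (charge `e(L^kε)^{(4−d)/2}` in the
transports on the right, p. 607), for `m² > 0`, `a_k ≥ 0`; the factor `(L^kε)²` is the dimension of an inverse
Laplacian.  PROVED — the general-`s` covariance `B1Eq38Rescale.propagatorK_rescale` at `s = (L^kε)⁻¹` and `covOpK_unit`.
[cite: Balaban1982Higgs1, (2.22) p.610] -/
theorem eq222 (C : ChargeData N) {msq : ℝ} (hmsq : 0 < msq) (a : ℝ) (k : ℕ) (hak : 0 ≤ B1.aSeq a P.L k)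
    (A' : VecField (P.scaleBy (unitScale P k) (unitScale_pos P k)) 0)
    (g' : ScalarField (P.scaleBy (unitScale P k) (unitScale_pos P k)) 0 N) :
    propagatorK (P := P) C Finset.univ (rescaleVec (unitScale_pos P k) A') msq a k
        (rescaleScalar (unitScale_pos P k) g')
      = P.mesh k ^ 2 • rescaleScalar (unitScale_pos P k)
          ((Ring.inverse
            (covLaplacianN (P := P.scaleBy (unitScale P k) (unitScale_pos P k))
                (C.scaleBy P.d (unitScale P k)) Finset.univ A'
              + (msq * P.mesh k ^ 2) • LinearMap.id
              + B1.aSeq a P.L k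
                • projPk (P := P.scaleBy (unitScale P k) (unitScale_pos P k)) (C.scaleBy P.d (unitScale P k)) A' k) :
              Module.End ℝ (ScalarField (P.scaleBy (unitScale P k) (unitScale_pos P k)) 0 N))
            g') := by
  rw [propagatorK_rescale (unitScale_pos P k) C A' hmsq a k hak g', unitScale_inv]
  unfold propagatorK
  rw [covOpK_unit]

/-- Transport of the propagator (2.20) along an equality of parameter records — used for the two descriptions
`P.scaleBy (L^kε)⁻¹` and `Params.unitAt k` of the unit lattice (`B1Eq338Rescaling.unitScale_eq_unitAt`), whose field
types agree only propositionally. [cite: Balaban1982Higgs1, (2.22) p.610] -/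
theorem propagatorK_cast {Q R : Params} (h : Q = R) (C : ChargeData N) (A : VecField Q 0) (msq a : ℝ) (k : ℕ)
    (g : ScalarField Q 0 N) :
    propagatorK (P := R) C Finset.univ (cast (congrArg (fun X : Params => VecField X 0) h) A) msq a k
        (cast (congrArg (fun X : Params => ScalarField X 0 N) h) g)
      = cast (congrArg (fun X : Params => ScalarField X 0 N) h) (propagatorK (P := Q) C Finset.univ A msq a k g) := by
  subst h
  rfl

/-- **(2.22) through the decl of record** `HiggsCovariance.propagatorRescaled` (row B1.Eq2.22: the construction (2.20)
over `Params.unitAt k` with the mass `m²(L^kε)²`): transported to the record `Params.unitAt k`, the unit-lattice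
propagator appearing in `eq222` IS `propagatorRescaled P e_s k T Ã′ m² a`.  Hence, with `eq222`:
`G^ε_k(T, σÃ′)(σg′) = (L^kε)²·σ·[G_k(T, Ã′) g′]`, `G_k` = `propagatorRescaled`. PROVED. [cite: Balaban1982Higgs1, (2.22) p.610] -/
theorem propagatorRescaled_eq_cast (C : ChargeData N) (k : ℕ) (msq a : ℝ)
    (A' : VecField (P.scaleBy (unitScale P k) (unitScale_pos P k)) 0)
    (g' : ScalarField (P.scaleBy (unitScale P k) (unitScale_pos P k)) 0 N) :
    propagatorRescaled P (C.scaleBy P.d (unitScale P k)) k Finset.univ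
        (cast (congrArg (fun X : Params => VecField X 0) (unitScale_eq_unitAt P k)) A') msq a
        (cast (congrArg (fun X : Params => ScalarField X 0 N) (unitScale_eq_unitAt P k)) g')
      = cast (congrArg (fun X : Params => ScalarField X 0 N) (unitScale_eq_unitAt P k))
          (propagatorK (P := P.scaleBy (unitScale P k) (unitScale_pos P k)) (C.scaleBy P.d (unitScale P k))
            Finset.univ A' (msq * P.mesh k ^ 2) a k g') :=
  propagatorK_cast (unitScale_eq_unitAt P k) (C.scaleBy P.d (unitScale P k)) A' (msq * P.mesh k ^ 2) a k g'

end Propagator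

/-! ## 2. (3.29) on the unit lattice: the background field `A^{(k)}` of (3.38) -/

section Background

variable {k : ℕ}

/-- **The conjugated background assignment of (3.38) is the rescaled (3.29)**: for `μ₀² > 0`, `a ≥ 0` and every `s > 0`,
`B1Eq338Rescaling.extRescale s (A ↦ A^{(k),ε}_{μ₀²}(A)) = (A′ ↦ A^{(k),sε}_{μ₀²s⁻²}(A′))` — i.e. `A^{(k),ε}(σA′) =
σ·A^{(k),sε}(A′)` (`HiggsBackgroundRescale.bgVec_rescale`, p. 607 *"μ₀² replaced by μ₀²s⁻²"*) read through the
definition of `extRescale`. PROVED. [cite: Balaban1982Higgs1, (3.29) p.617] -/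
theorem extRescale_bgVec (hs : 0 < s) {mu0sq a : ℝ} (hmu : 0 < mu0sq) (ha : 0 ≤ a) (k : ℕ) :
    extRescale hs (fun A : VecField P k => bgVec (P := P) mu0sq a k A)
      = fun A' : VecField (P.scaleBy s hs) k => bgVec (P := P.scaleBy s hs) (mu0sq * s⁻¹ ^ 2) a k A' := by
  have hσ : s ^ (((P.d : ℝ) - 2) / 2) ≠ 0 := (Real.rpow_pos_of_pos hs _).ne'
  funext A' b
  have h := congrFun (bgVec_rescale (P := P) hs hmu ha k A') ⟨b.src, b.dir⟩
  simp only [extRescale, h, rescaleVec, inv_mul_cancel_left₀ hσ]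

/-- On the unit lattice with the mass `μ₀²(L^kε)²`: `extRescale (L^kε)⁻¹ (A ↦ A^{(k),ε}_{μ₀²}(A)) =
(A′ ↦ A^{(k)}_{μ₀²(L^kε)²}(A′))`, the `A^{(k)}` of (3.38). PROVED. [cite: Balaban1982Higgs1, (3.38) p.619] -/
theorem extRescale_bgVec_unit {mu0sq a : ℝ} (hmu : 0 < mu0sq) (ha : 0 ≤ a) (k : ℕ) :
    extRescale (unitScale_pos P k) (fun A : VecField P k => bgVec (P := P) mu0sq a k A)
      = fun A' : VecField (P.scaleBy (unitScale P k) (unitScale_pos P k)) k =>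
          bgVec (P := P.scaleBy (unitScale P k) (unitScale_pos P k)) (mu0sq * P.mesh k ^ 2) a k A' := by
  rw [extRescale_bgVec (unitScale_pos P k) hmu ha k, unitScale_inv]

/-- **`A^{(k)} = a_kG_kQ_k^*A` on the unit lattice** (the map of (3.38), expanded in (3.42) p. 619: *"the field A occurs
only through the function A^{(k)} … A^{(k)} = a_kG_kQ_k^*A′ + …"*): on `P₁` the (3.29) combination
`a_k(L^kη)^{−2}G^η_kQ_k^*` has `(L^kη)^{−2} = 1`, `G_k = G_k(T, 0; μ²)` the propagator (2.20)/(2.22) of `P₁` at the zero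
field. PROVED. [cite: Balaban1982Higgs1, (3.42) p.619] -/
theorem bgVec_unit (musq a : ℝ) (k : ℕ) (A : VecField (P.scaleBy (unitScale P k) (unitScale_pos P k)) k) :
    bgVec (P := P.scaleBy (unitScale P k) (unitScale_pos P k)) musq a k A
      = ofSite (P := P.scaleBy (unitScale P k) (unitScale_pos P k))
          (B1.aSeq a P.L k
            • propagatorK (P := P.scaleBy (unitScale P k) (unitScale_pos P k)) (zeroCharge P.d) Finset.univ
                (0 : VecField (P.scaleBy (unitScale P k) (unitScale_pos P k)) 0) musq a k
                (avgQkAdj (P := P.scaleBy (unitScale P k) (unitScale_pos P k)) (zeroCharge P.d)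
                  (0 : VecField (P.scaleBy (unitScale P k) (unitScale_pos P k)) 0) k
                  (toSite (P := P.scaleBy (unitScale P k) (unitScale_pos P k)) A))) := by
  unfold bgVec topPiece
  rw [B3MultiscaleFields.fluctOp_eq, unit_mesh_k, one_pow, inv_one, mul_one]
  rfl

end Background

/-! ## 3. (3.38) for the (Higgs)₂,₃ model, every piece identified -/

section Model

variable {k : ℕ}

/-- **(3.38) p. 619 for the (Higgs)₂,₃ model** — at the rescalings `(B, ψ) = (σB′, σψ′)` of unit-lattice block fields,
for `μ₀², m² > 0`, `a ≥ 0`, length scales `ℓ₀, ℓ₁ > 0` of the characteristic functions (3.27)–(3.28) (in print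
`ℓ₀ = L^kε`, `ℓ₁ = L^{k+1}ε`, see `eq338_model_printed`) and an action `S^{(k),L^kε}` of the form (3.30):
`χ_{k+1}(B)χ_{k+1}(B,ψ)·T^{L^kε}_{a,L}[T^{L^kε}_{a,L,A^{(k),ε}}[χ_k(A)χ_k(A,φ)e^{−S^{(k)}}]](B,ψ)
 = const·χ^{sℓ₁}_{k+1}(B′)χ^{sℓ₁}_{k+1}(B′,ψ′) ∫dA′∫dφ′ χ^{sℓ₀}_k(A′)χ^{sℓ₀}_k(A′,φ′) exp[−½aL^{d−2}Σ_y|B′(y)−(QA′)(y)|²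
 − ½aL^{d−2}Σ_y|ψ′(y)−(Q(A^{(k)})φ′)(y)|² − ½⟨A′,Δ^{(k)}A′⟩ − ½⟨φ′,Δ^{(k)}(A^{(k)})φ′⟩ + log Z_k + log Z_k(A^{(k)}) +
 𝒫^{(k)}(A^{(k)},φ′) − E₀]` = `display338` on `P₁`, `s = (L^kε)⁻¹`, where NOW: the weights are the characteristic
functions OF THE UNIT LATTICE (masses `μ₀²(L^kε)²`, `m²(L^kε)²`, charge `e_s`; `B1Eq38Rescale.chiKA_rescale`/`chiKφ_rescale`),
the background is `A^{(k)} = A^{(k)}_{μ₀²(L^kε)²}` of `P₁` (`= a_kG_kQ_k^*A′`, `bgVec_unit`; `extRescale_bgVec_unit`), the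
quadratic forms / `Z_k(·)` / `𝒫^{(k)}` are the (3.30) constituents pulled back under (1.22), `const = rescaleConstK`.
PROVED (`B1Eq338Display.eq338` + the typer's covariance lemmas). [cite: Balaban1982Higgs1, (3.38) p.619] -/
theorem eq338_model (C : ChargeData N) {mu0sq msq a : ℝ} (hmu : 0 < mu0sq) (hmsq : 0 < msq) (ha : 0 ≤ a) (k : ℕ)
    {ℓ₀ ℓ₁ : ℝ} (hℓ₀ : 0 < ℓ₀) (hℓ₁ : 0 < ℓ₁) (p₀ p₁ : ℝ)
    {S : VecField P k → ScalarField P k N → ℝ} {logZk E₀ : ℝ} {logZkA : VecField P 0 → ℝ}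
    {formA : VecField P k → ℝ} {formφ Pk : VecField P 0 → ScalarField P k N → ℝ}
    (hS : ∀ A φ, S A φ = action330 logZk (logZkA (bgVec mu0sq a k A)) (formA A) (formφ (bgVec mu0sq a k A) φ)
      (Pk (bgVec mu0sq a k A) φ) E₀)
    (B' : VecField (P.scaleBy (unitScale P k) (unitScale_pos P k)) (k + 1))
    (ψ' : ScalarField (P.scaleBy (unitScale P k) (unitScale_pos P k)) (k + 1) N) :
    chiKA ℓ₁ p₁ mu0sq a (k + 1) (rescaleVec (unitScale_pos P k) B')
        * chiKφ C ℓ₁ p₁ mu0sq msq a (k + 1) (rescaleVec (unitScale_pos P k) B') (rescaleScalar (unitScale_pos P k) ψ')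
        * doubleRTk C a (fun A : VecField P k => bgVec mu0sq a k A) (cutoffDensity C ℓ₀ p₀ mu0sq msq a k S)
            (rescaleVec (unitScale_pos P k) B') (rescaleScalar (unitScale_pos P k) ψ')
      = display338 (P.scaleBy (unitScale P k) (unitScale_pos P k)) k (C.scaleBy P.d (unitScale P k)) a
          (rescaleConstK P k N a (unitScale P k))
          (fun B ψ => chiKA (P := P.scaleBy (unitScale P k) (unitScale_pos P k)) (unitScale P k * ℓ₁) p₁
              (mu0sq * P.mesh k ^ 2) a (k + 1) B
            * chiKφ (P := P.scaleBy (unitScale P k) (unitScale_pos P k)) (C.scaleBy P.d (unitScale P k))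
              (unitScale P k * ℓ₁) p₁ (mu0sq * P.mesh k ^ 2) (msq * P.mesh k ^ 2) a (k + 1) B ψ)
          (fun A φ => chiKA (P := P.scaleBy (unitScale P k) (unitScale_pos P k)) (unitScale P k * ℓ₀) p₀
              (mu0sq * P.mesh k ^ 2) a k A
            * chiKφ (P := P.scaleBy (unitScale P k) (unitScale_pos P k)) (C.scaleBy P.d (unitScale P k))
              (unitScale P k * ℓ₀) p₀ (mu0sq * P.mesh k ^ 2) (msq * P.mesh k ^ 2) a k A φ)
          (fun A => bgVec (P := P.scaleBy (unitScale P k) (unitScale_pos P k)) (mu0sq * P.mesh k ^ 2) a k A) logZk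
          (fun Ab => logZkA (rescaleVec (unitScale_pos P k) Ab))
          (fun A => formA (rescaleVec (unitScale_pos P k) A))
          (fun Ab φ => formφ (rescaleVec (unitScale_pos P k) Ab) (rescaleScalar (unitScale_pos P k) φ))
          (fun Ab φ => Pk (rescaleVec (unitScale_pos P k) Ab) (rescaleScalar (unitScale_pos P k) φ)) E₀ B' ψ' := by
  have hρ : cutoffDensity C ℓ₀ p₀ mu0sq msq a k S
      = fun A φ => (chiKA ℓ₀ p₀ mu0sq a k A * chiKφ C ℓ₀ p₀ mu0sq msq a k A φ) * Real.exp (-S A φ) := by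
    funext A φ
    rfl
  have h := eq338 (P := P) C a (fun A : VecField P k => bgVec mu0sq a k A)
    (fun B ψ => chiKA ℓ₁ p₁ mu0sq a (k + 1) B * chiKφ C ℓ₁ p₁ mu0sq msq a (k + 1) B ψ)
    (fun A φ => chiKA ℓ₀ p₀ mu0sq a k A * chiKφ C ℓ₀ p₀ mu0sq msq a k A φ) hS B' ψ'
  beta_reduce at h
  rw [hρ, h, extRescale_bgVec_unit hmu ha k]
  simp only [chiKA_rescale (unitScale_pos P k) hℓ₁ p₁ hmu ha, chiKφ_rescale (unitScale_pos P k) hℓ₁ C p₁ hmu hmsq ha,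
    chiKA_rescale (unitScale_pos P k) hℓ₀ p₀ hmu ha, chiKφ_rescale (unitScale_pos P k) hℓ₀ C p₀ hmu hmsq ha,
    unitScale_inv]

/-- `(L^kε)⁻¹ · L^kε = 1`: the scale of `χ_k` becomes that of the unit lattice `T_1^{(k)}`. [cite: Balaban1982Higgs1, (3.38) p.619] -/
theorem unitScale_mul_mesh_k (P : Params) (k : ℕ) : unitScale P k * P.mesh k = 1 := by
  rw [unitScale, inv_mul_cancel₀ (P.mesh_pos k).ne']

/-- `(L^kε)⁻¹ · L^{k+1}ε = L`: the scale of `χ_{k+1}` becomes that of `T_L^{(k+1)}`. [cite: Balaban1982Higgs1, (3.38) p.619] -/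
theorem unitScale_mul_mesh_succ (P : Params) (k : ℕ) : unitScale P k * P.mesh (k + 1) = P.L := by
  rw [mesh_succ, mul_left_comm, unitScale_mul_mesh_k, mul_one]

/-- **(3.38) AS PRINTED for the (Higgs)₂,₃ model**: `eq338_model` at the printed thresholds — `χ_k` of (3.27)–(3.28) at
the scale `L^kε`, `χ_{k+1}` at `L^{k+1}ε` — where the rescaled weights are the characteristic functions of the unit
lattice `T_1^{(k)}` (scale `1`) and of `T_L^{(k+1)}` (scale `L`), as displayed in (3.38). PROVED. [cite: Balaban1982Higgs1, (3.38) p.619] -/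
theorem eq338_model_printed (C : ChargeData N) {mu0sq msq a : ℝ} (hmu : 0 < mu0sq) (hmsq : 0 < msq) (ha : 0 ≤ a)
    (k : ℕ) (p₀ p₁ : ℝ)
    {S : VecField P k → ScalarField P k N → ℝ} {logZk E₀ : ℝ} {logZkA : VecField P 0 → ℝ}
    {formA : VecField P k → ℝ} {formφ Pk : VecField P 0 → ScalarField P k N → ℝ}
    (hS : ∀ A φ, S A φ = action330 logZk (logZkA (bgVec mu0sq a k A)) (formA A) (formφ (bgVec mu0sq a k A) φ)
      (Pk (bgVec mu0sq a k A) φ) E₀)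
    (B' : VecField (P.scaleBy (unitScale P k) (unitScale_pos P k)) (k + 1))
    (ψ' : ScalarField (P.scaleBy (unitScale P k) (unitScale_pos P k)) (k + 1) N) :
    chiKA (P.mesh (k + 1)) p₁ mu0sq a (k + 1) (rescaleVec (unitScale_pos P k) B')
        * chiKφ C (P.mesh (k + 1)) p₁ mu0sq msq a (k + 1) (rescaleVec (unitScale_pos P k) B')
            (rescaleScalar (unitScale_pos P k) ψ')
        * doubleRTk C a (fun A : VecField P k => bgVec mu0sq a k A) (cutoffDensity C (P.mesh k) p₀ mu0sq msq a k S)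
            (rescaleVec (unitScale_pos P k) B') (rescaleScalar (unitScale_pos P k) ψ')
      = display338 (P.scaleBy (unitScale P k) (unitScale_pos P k)) k (C.scaleBy P.d (unitScale P k)) a
          (rescaleConstK P k N a (unitScale P k))
          (fun B ψ => chiKA (P := P.scaleBy (unitScale P k) (unitScale_pos P k)) P.L p₁
              (mu0sq * P.mesh k ^ 2) a (k + 1) B
            * chiKφ (P := P.scaleBy (unitScale P k) (unitScale_pos P k)) (C.scaleBy P.d (unitScale P k))
              P.L p₁ (mu0sq * P.mesh k ^ 2) (msq * P.mesh k ^ 2) a (k + 1) B ψ)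
          (fun A φ => chiKA (P := P.scaleBy (unitScale P k) (unitScale_pos P k)) 1 p₀
              (mu0sq * P.mesh k ^ 2) a k A
            * chiKφ (P := P.scaleBy (unitScale P k) (unitScale_pos P k)) (C.scaleBy P.d (unitScale P k))
              1 p₀ (mu0sq * P.mesh k ^ 2) (msq * P.mesh k ^ 2) a k A φ)
          (fun A => bgVec (P := P.scaleBy (unitScale P k) (unitScale_pos P k)) (mu0sq * P.mesh k ^ 2) a k A) logZk
          (fun Ab => logZkA (rescaleVec (unitScale_pos P k) Ab))
          (fun A => formA (rescaleVec (unitScale_pos P k) A))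
          (fun Ab φ => formφ (rescaleVec (unitScale_pos P k) Ab) (rescaleScalar (unitScale_pos P k) φ))
          (fun Ab φ => Pk (rescaleVec (unitScale_pos P k) Ab) (rescaleScalar (unitScale_pos P k) φ)) E₀ B' ψ' := by
  have h := eq338_model C hmu hmsq ha k (P.mesh_pos k) (P.mesh_pos (k + 1)) p₀ p₁ hS B' ψ'
  rw [unitScale_mul_mesh_k, unitScale_mul_mesh_succ] at h
  exact h

end Model

end Literature.MathematicalPhysics.QuantumFieldTheory.Balaban1983to89.B1Eq222Rescaling
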